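import Summits.QuantumFields.YangMills.Theorems.AtomicCalibrationRAtomCeilings

/-!
# Leaf `HypercubicOSDataFromInfiniteVolume` (stmt-QuantumFields-19868), stub CAL `stub_temperedCalibrationK` — part 1/3: the SCALE-LOCAL form of E1
# (`AtomicCalibrationR.MirrorCalibration.core_above/…/atomCeiling_proof` with the onset hypothesis replaced by a bound at ONE scale)

The landed E1 (`AtomCeilings`, planner ym-idea-11 g15, ✓`atomCeilings_holds`) derives far-mirror atom ceilings at every scale `s > A` from ONSET
DOMINATION (`∀ s' ∈ onsetSet r μ b ε, s' ≤ A`).  Its proof (OS contraction `Contracts`, time mirror, axis transposition — all at the SAME scale and in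
the SAME state) uses that hypothesis only through «every sub-cell-offset atom of scale `s` has RP square `< ε`».  The tempered calibration CAL needs
exactly this scale-local form, because its level `η = ε (s/aβ)^M` depends on the scale: this file is the E1 proof VERBATIM with the pair
`(ε, A, hA, A < s)` replaced by `(η ≥ 0, hloc : ∀ q₁, ∀ y₁ ∈ [0,s]⁴, rpSquare r μ b {q₁} s y₁ ≤ η)`:

* `core_above_local`, `core_below_local`, `core_zero_local`, `core_axis_local` — the four cores;
* `atomCeiling_local` — all axes `k`, all planes `c`, both sides: the reflected double sum of an admissible-profile atom of scale `s` in an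
  odd-torus limit state is `≤ η`.

Lattice-symmetry plumbing only (credit: the E1 file); nothing here is a β-uniform bound; no stub/crux/rung/leaf/summit is closed by THIS file;
the Yang–Mills mass gap is NOT proved. [folklore]
-/

set_option autoImplicit false

noncomputable section

open scoped BigOperators
open MeasureTheory Filter Topology
open Literature.MathematicalPhysics.QuantumFieldTheory Literature.MathematicalPhysics.QuantumLattice
open Literature.Probability.LatticeModels (Site)
open Summit.QuantumFields.YangMills.Theorems.InfiniteVolume (stateMomentStr stateMomentStr_configPermZd
  stateMomentStr_reflSite stateMomentStr_translate_of_mem_oddTorusLimitPoints plane_configPermZd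
  single_add_single_permPlane)
open Summit.QuantumFields.YangMills.Theorems.InfVolRP (centreOffset centreOffset_time two_mul_centreOffset_zero
  reflSite_apply_zero reflSite_apply_of_ne smul_reflSite_add_of_centre
  mem_infiniteVolumeLimitPoints_of_mem_oddTorusLimitPoints)
open Summit.QuantumFields.YangMills.Theorems.OSLegsFromFemtoAndGap (permPlane permPlane_valid)
open Summit.QuantumFields.GaugeBoot (map_configPermZd_eq_of_mem_infiniteVolumeLimitPoints
  map_configSiteReflect_zero_eq_of_mem_infiniteVolumeLimitPoints)
open Summit.QuantumFields.YangMills.Theses.OnsetTautology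
open Summit.QuantumFields.YangMills.Cruxes.AtomicCalibrationR.MirrorCalibration

namespace Summit.QuantumFields.YangMills.Cruxes.HypercubicOSDataFromInfiniteVolume.TemperedCalibration

variable {G : Type} [Group G] [TopologicalSpace G] [IsTopologicalGroup G] [CompactSpace G]
  [MeasurableSpace G] [BorelSpace G]

/-- **Core (above), scale-local form.**  At scale `s` every sub-cell-offset atom has RP square `≤ η`; mirror `x₀ = c`, every carrier site at `x₀ ≥ c + t/s`:
the reflected double sum is `≤ η`. -/
theorem core_above_local (r : LatticeRep G) {β : ℝ} {μ : Measure (LGConfig 4 G)} (hμ : μ ∈ oddTorusLimitPoints r β)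
    (b : SchwartzMap (EuclideanSpace ℝ (Fin 4)) ℝ) (hcon : Contracts r μ b) (η : ℝ) (hη : 0 ≤ η)
    (S : Finset ((Fin 4 × Fin 4) × (Fin 4 → ℤ))) (q : Fin 4 × Fin 4)
    (s t : ℝ) (y : EuclideanSpace ℝ (Fin 4)) (c : ℤ) (hs : 0 < s)
    (hloc : ∀ (q₁ : Fin 4 × Fin 4) (y₁ : EuclideanSpace ℝ (Fin 4)), (∀ i, 0 ≤ y₁ i ∧ y₁ i ≤ s) → rpSquare r μ b {q₁} s y₁ ≤ η)
    (ht : ∀ u, b u ≠ 0 → ‖u‖ ≤ t) (hS : ∀ p, atomWt b {q} s y p ≠ 0 → p ∈ S)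
    (hside : ∀ p ∈ S, (c : ℝ) + t / s ≤ ((p.2 0 : ℤ) : ℝ)) :
    ∑ p ∈ S, ∑ p' ∈ S, atomWt b {q} s y p * atomWt b {q} s y p' *
        stateMomentStr G r μ 2 ![p.1, p'.1] ![reflSite 0 c p, p'.2] ≤ η := by
  by_cases h0 : ∀ p ∈ S, atomWt b {q} s y p = 0
  · rw [Finset.sum_eq_zero fun p hp => Finset.sum_eq_zero fun p' _ => by rw [h0 p hp, zero_mul, zero_mul]]
    exact hη
  simp only [not_forall] at h0
  obtain ⟨p₀, hp₀, hw₀⟩ := h0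
  obtain ⟨-, hval, hb₀⟩ := (atomWt_ne_zero_iff_flat b {q} s y p₀).1 hw₀
  -- the time offset relative to the mirror is ≥ 0
  have hu0 : |(s • (siteToE p₀.2 + centreOffset p₀.1) - y) 0| ≤ t :=
    le_trans (by simpa only [Real.norm_eq_abs] using PiLp.norm_apply_le (s • (siteToE p₀.2 + centreOffset p₀.1) - y) 0)
      (ht _ hb₀)
  rw [atomArg_apply] at hu0
  have ho := (centreOffset_time p₀.1).1
  have hsd := hside p₀ hp₀
  have h1 : t ≤ s * (((p₀.2 0 : ℤ) : ℝ) - c) := by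
    have := mul_le_mul_of_nonneg_left hsd hs.le
    rw [mul_add, mul_div_cancel₀ t hs.ne'] at this
    linarith
  have hyc : 0 ≤ y 0 - s * c := by
    have := (abs_le.1 hu0).2
    nlinarith
  -- the shift vector
  let v : Site 4 := fun i => if i = 0 then c else ⌊y i / s⌋
  have hv0 : v 0 = c := by simp [v]
  rw [reflectedDoubleSum_shift r hμ b S q s y c v hv0 hS]
  have hy₁ : ∀ i, (y - s • siteToE v) i = y i - s * (v i : ℝ) := fun i => by
    simp only [PiLp.sub_apply, PiLp.smul_apply, siteToE_apply, smul_eq_mul]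
  have hy₁0 : 0 ≤ (y - s • siteToE v) 0 := by rw [hy₁, hv0]; exact hyc
  have hy₁i : ∀ i, i ≠ 0 → 0 ≤ (y - s • siteToE v) i ∧ (y - s • siteToE v) i < s := by
    intro i hi
    rw [hy₁]
    have hvi : (v i : ℝ) = ((⌊y i / s⌋ : ℤ) : ℝ) := by simp [v, hi]
    rw [hvi]
    have h1 := Int.floor_le (y i / s)
    have h2 := Int.lt_floor_add_one (y i / s)
    rw [le_div_iff₀ hs] at h1
    rw [div_lt_iff₀ hs] at h2
    constructor <;> nlinarith
  -- walk down to the sub-cell offset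
  set y₁ : EuclideanSpace ℝ (Fin 4) := y - s • siteToE v with hy₁def
  let m : ℕ := ⌊y₁ 0 / s⌋₊
  have hm1 : (m : ℝ) ≤ y₁ 0 / s := Nat.floor_le (div_nonneg hy₁0 hs.le)
  have hm2 : y₁ 0 / s < m + 1 := Nat.lt_floor_add_one _
  rw [le_div_iff₀ hs] at hm1
  rw [div_lt_iff₀ hs] at hm2
  let y' : EuclideanSpace ℝ (Fin 4) := y₁ - (s * (m : ℝ)) • EuclideanSpace.single 0 (1 : ℝ)
  have hy'ap : ∀ i, y' i = y₁ i - (if i = 0 then s * (m : ℝ) else 0) := fun i => by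
    simp only [y', PiLp.sub_apply, PiLp.smul_apply, PiLp.single_apply, smul_eq_mul, mul_ite, mul_one,
      mul_zero]
  have hy' : ∀ i, 0 ≤ y' i ∧ y' i ≤ s := by
    intro i
    rw [hy'ap]
    by_cases hi : i = 0
    · subst hi
      rw [if_pos rfl]
      constructor <;> nlinarith
    · rw [if_neg hi, sub_zero]
      exact ⟨(hy₁i i hi).1, (hy₁i i hi).2.le⟩
  have hcon' : rpSquare r μ b {q} s (y' + (s * (m : ℝ)) • EuclideanSpace.single 0 (1 : ℝ)) ≤
      rpSquare r μ b {q} s y' := hcon {q} s y' m hs (hy' 0).1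
  have hyy : y' + (s * (m : ℝ)) • EuclideanSpace.single 0 (1 : ℝ) = y₁ := sub_add_cancel _ _
  rw [hyy] at hcon'
  exact hcon'.trans (hloc q y' hy')


/-! ## §B/§0/§C The mirrored and transposed cores (scale-local) -/


/-- **Core (below).**  Mirror `x₀ = c`, every carrier site at `x₀ + t/s + 2 ≤ c`: reflect state and profile in time
and apply `core_above` to the mirrored atom (which sits at `x₀ ≥ c + t/s + 1`). -/
theorem core_below_local [T2Space G] [SecondCountableTopology G] (r : LatticeRep G) {β : ℝ} {μ : Measure (LGConfig 4 G)}
    (hμ : μ ∈ oddTorusLimitPoints r β) (b : SchwartzMap (EuclideanSpace ℝ (Fin 4)) ℝ) (hcon : Contracts r μ b)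
    {T : ℝ} (hT : ∀ u : EuclideanSpace ℝ (Fin 4), b (WithLp.toLp 2 fun i => if i = 0 then T - u i else u i) = b u)
    (η : ℝ) (hη : 0 ≤ η) (S : Finset ((Fin 4 × Fin 4) × (Fin 4 → ℤ)))
    (q : Fin 4 × Fin 4) (s t : ℝ) (y : EuclideanSpace ℝ (Fin 4)) (c : ℤ) (hs : 0 < s)
    (hloc : ∀ (q₁ : Fin 4 × Fin 4) (y₁ : EuclideanSpace ℝ (Fin 4)), (∀ i, 0 ≤ y₁ i ∧ y₁ i ≤ s) → rpSquare r μ b {q₁} s y₁ ≤ η)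
    (ht : ∀ u, b u ≠ 0 → ‖u‖ ≤ t) (hS : ∀ p, atomWt b {q} s y p ≠ 0 → p ∈ S)
    (hside : ∀ p ∈ S, ((p.2 0 : ℤ) : ℝ) + t / s + 2 ≤ (c : ℝ)) :
    ∑ p ∈ S, ∑ p' ∈ S, atomWt b {q} s y p * atomWt b {q} s y p' *
        stateMomentStr G r μ 2 ![p.1, p'.1] ![reflSite 0 c p, p'.2] ≤ η := by
  classical
  -- Step 1: only plaquettes with non-zero weight matter
  have hmem₀ : ∀ p, p ∈ S.filter (fun p => atomWt b {q} s y p ≠ 0) ↔ p ∈ S ∧ atomWt b {q} s y p ≠ 0 :=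
    fun p => Finset.mem_filter
  rw [← Finset.sum_filter_of_ne (s := S) (p := fun p => atomWt b {q} s y p ≠ 0) (fun p _ hne h0 =>
    hne (Finset.sum_eq_zero fun p' _ => by rw [h0, zero_mul, zero_mul]))]
  rw [Finset.sum_congr rfl fun p _ => (Finset.sum_filter_of_ne (s := S) (p := fun p' => atomWt b {q} s y p' ≠ 0)
    (f := fun p' => atomWt b {q} s y p * atomWt b {q} s y p' * stateMomentStr G r μ 2 ![p.1, p'.1]
      ![reflSite 0 c p, p'.2]) (fun p' _ hne h0 => hne (by rw [h0, mul_zero, zero_mul]))).symm]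
  -- Step 2: re-index by the mirror `hat`
  let hat : (Fin 4 × Fin 4) × (Fin 4 → ℤ) → (Fin 4 × Fin 4) × (Fin 4 → ℤ) := fun p => (p.1, reflSite 0 c p)
  have hhat : ∀ p, hat (hat p) = p := fun p => Prod.ext rfl (reflSite_zero_invol c p)
  have hinj : Set.InjOn hat ↑(S.filter fun p => atomWt b {q} s y p ≠ 0) := fun p _ p' _ h => by
    have h' := congrArg hat h
    rwa [hhat, hhat] at h'
  have hyh : y + (2 * s * c - 2 * y 0 - T) • EuclideanSpace.single 0 (1 : ℝ) =
      y + (2 * s * c - 2 * y 0 - T) • EuclideanSpace.single 0 (1 : ℝ) := rfl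
  have key := core_above_local r hμ b hcon η hη ((S.filter fun p => atomWt b {q} s y p ≠ 0).image hat) q s t
    (y + (2 * s * c - 2 * y 0 - T) • EuclideanSpace.single 0 (1 : ℝ)) c hs hloc ht ?_ ?_
  · rw [Finset.sum_image hinj] at key
    refine le_of_eq_of_le (Finset.sum_congr rfl fun p hp => ?_) key
    rw [Finset.sum_image hinj]
    refine Finset.sum_congr rfl fun p' hp' => ?_
    have hv : p.1.1 < p.1.2 := ((atomWt_ne_zero_iff_flat b {q} s y p).1 ((hmem₀ p).1 hp).2).2.1
    have hv' : p'.1.1 < p'.1.2 := ((atomWt_ne_zero_iff_flat b {q} s y p').1 ((hmem₀ p').1 hp').2).2.1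
    dsimp only [hat]
    rw [atomWt_hat hT {q} s y c _ hyh, atomWt_hat hT {q} s y c _ hyh]
    dsimp only
    rw [reflSite_zero_invol, reflSite_zero_invol, Prod.mk.eta, Prod.mk.eta, M2_reflect_swap r hμ p p' hv hv' c]
  · -- carrier of the mirrored atom
    intro ph hph
    rw [atomWt_hat hT {q} s y c _ hyh] at hph
    rw [Finset.mem_image]
    exact ⟨(ph.1, reflSite 0 c ph), (hmem₀ _).2 ⟨hS _ hph, hph⟩, Prod.ext rfl (reflSite_zero_invol c ph)⟩
  · -- the mirrored atom sits at `x₀ ≥ c + t/s + 1`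
    intro ph hph
    rw [Finset.mem_image] at hph
    obtain ⟨p, hp, rfl⟩ := hph
    have hsd := hside p ((hmem₀ p).1 hp).1
    show (c : ℝ) + t / s ≤ ((reflSite 0 c p 0 : ℤ) : ℝ)
    simp only [reflSite, if_true]
    split_ifs <;> push_cast <;> linarith

/-- **Core (axis 0).**  Both sides of the mirror `x₀ = c`. -/
theorem core_zero_local [T2Space G] [SecondCountableTopology G] (r : LatticeRep G) {β : ℝ} {μ : Measure (LGConfig 4 G)}
    (hμ : μ ∈ oddTorusLimitPoints r β) (b : SchwartzMap (EuclideanSpace ℝ (Fin 4)) ℝ) (hcon : Contracts r μ b)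
    {T : ℝ} (hT : ∀ u : EuclideanSpace ℝ (Fin 4), b (WithLp.toLp 2 fun i => if i = 0 then T - u i else u i) = b u)
    (η : ℝ) (hη : 0 ≤ η) (S : Finset ((Fin 4 × Fin 4) × (Fin 4 → ℤ)))
    (q : Fin 4 × Fin 4) (s t : ℝ) (y : EuclideanSpace ℝ (Fin 4)) (c : ℤ) (hs : 0 < s)
    (hloc : ∀ (q₁ : Fin 4 × Fin 4) (y₁ : EuclideanSpace ℝ (Fin 4)), (∀ i, 0 ≤ y₁ i ∧ y₁ i ≤ s) → rpSquare r μ b {q₁} s y₁ ≤ η)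
    (ht : ∀ u, b u ≠ 0 → ‖u‖ ≤ t) (hS : ∀ p, atomWt b {q} s y p ≠ 0 → p ∈ S)
    (hside : (∀ p ∈ S, ((p.2 0 : ℤ) : ℝ) + t / s + 2 ≤ (c : ℝ)) ∨
      (∀ p ∈ S, (c : ℝ) + t / s + 2 ≤ ((p.2 0 : ℤ) : ℝ))) :
    ∑ p ∈ S, ∑ p' ∈ S, atomWt b {q} s y p * atomWt b {q} s y p' *
        stateMomentStr G r μ 2 ![p.1, p'.1] ![reflSite 0 c p, p'.2] ≤ η :=
  hside.elim (core_below_local r hμ b hcon hT η hη S q s t y c hs hloc ht hS) fun h =>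
    core_above_local r hμ b hcon η hη S q s t y c hs hloc ht hS fun p hp => by linarith [h p hp]

/-- **Core (axis `k ≠ 0`).**  Transpose state, orientation, sites and profile by `(0 k)` and apply `core_zero`. -/
theorem core_axis_local [T2Space G] [SecondCountableTopology G] (r : LatticeRep G) {β : ℝ} {μ : Measure (LGConfig 4 G)}
    (hμ : μ ∈ oddTorusLimitPoints r β) (b : SchwartzMap (EuclideanSpace ℝ (Fin 4)) ℝ) (hcon : Contracts r μ b)
    {T : ℝ} (hT : ∀ u : EuclideanSpace ℝ (Fin 4), b (WithLp.toLp 2 fun i => if i = 0 then T - u i else u i) = b u)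
    (hperm : ∀ (π : Equiv.Perm (Fin 4)) (u : EuclideanSpace ℝ (Fin 4)), b (WithLp.toLp 2 fun i => u (π i)) = b u)
    (η : ℝ) (hη : 0 ≤ η) (S : Finset ((Fin 4 × Fin 4) × (Fin 4 → ℤ)))
    (q : Fin 4 × Fin 4) (s t : ℝ) (y : EuclideanSpace ℝ (Fin 4)) (k : Fin 4) (c : ℤ) (hk : k ≠ 0)
    (hq : q.1 < q.2) (hs : 0 < s)
    (hloc : ∀ (q₁ : Fin 4 × Fin 4) (y₁ : EuclideanSpace ℝ (Fin 4)), (∀ i, 0 ≤ y₁ i ∧ y₁ i ≤ s) → rpSquare r μ b {q₁} s y₁ ≤ η) (ht : ∀ u, b u ≠ 0 → ‖u‖ ≤ t)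
    (hS : ∀ p, atomWt b {q} s y p ≠ 0 → p ∈ S)
    (hside : (∀ p ∈ S, ((p.2 k : ℤ) : ℝ) + t / s + 2 ≤ (c : ℝ)) ∨
      (∀ p ∈ S, (c : ℝ) + t / s + 2 ≤ ((p.2 k : ℤ) : ℝ))) :
    ∑ p ∈ S, ∑ p' ∈ S, atomWt b {q} s y p * atomWt b {q} s y p' *
        stateMomentStr G r μ 2 ![p.1, p'.1] ![reflSite k c p, p'.2] ≤ η := by
  classical
  have hmem₀ : ∀ p, p ∈ S.filter (fun p => atomWt b {q} s y p ≠ 0) ↔ p ∈ S ∧ atomWt b {q} s y p ≠ 0 :=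
    fun p => Finset.mem_filter
  have hq₀ : ∀ p ∈ S.filter (fun p => atomWt b {q} s y p ≠ 0), p.1 = q := fun p hp =>
    Finset.mem_singleton.1 ((atomWt_ne_zero_iff_flat b {q} s y p).1 ((hmem₀ p).1 hp).2).1
  -- Step 1: only plaquettes with non-zero weight matter
  rw [← Finset.sum_filter_of_ne (s := S) (p := fun p => atomWt b {q} s y p ≠ 0) (fun p _ hne h0 =>
    hne (Finset.sum_eq_zero fun p' _ => by rw [h0, zero_mul, zero_mul]))]
  rw [Finset.sum_congr rfl fun p _ => (Finset.sum_filter_of_ne (s := S) (p := fun p' => atomWt b {q} s y p' ≠ 0)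
    (f := fun p' => atomWt b {q} s y p * atomWt b {q} s y p' * stateMomentStr G r μ 2 ![p.1, p'.1]
      ![reflSite k c p, p'.2]) (fun p' _ hne h0 => hne (by rw [h0, mul_zero, zero_mul]))).symm]
  -- Step 2: re-index by the transposition `hat`
  let hat : (Fin 4 × Fin 4) × (Fin 4 → ℤ) → (Fin 4 × Fin 4) × (Fin 4 → ℤ) := fun p =>
    (permPlane (Equiv.swap 0 k) p.1, sitePermZd (Equiv.swap 0 k) p.2)
  have hinj : Set.InjOn hat ↑(S.filter fun p => atomWt b {q} s y p ≠ 0) := fun p hp p' hp' h => by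
    have h1 : p.1 = p'.1 := by rw [hq₀ p hp, hq₀ p' hp']
    have h2 : sitePermZd (Equiv.swap 0 k) p.2 = sitePermZd (Equiv.swap 0 k) p'.2 := (Prod.mk.inj h).2
    exact Prod.ext h1 ((sitePermZd (Equiv.swap 0 k)).injective h2)
  have hyh : (WithLp.toLp 2 fun i => y (Equiv.swap 0 k i) : EuclideanSpace ℝ (Fin 4)) =
      WithLp.toLp 2 fun i => y (Equiv.swap 0 k i) := rfl
  have key := core_zero_local r hμ b hcon hT η hη ((S.filter fun p => atomWt b {q} s y p ≠ 0).image hat)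
    (permPlane (Equiv.swap 0 k) q) s t (WithLp.toLp 2 fun i => y (Equiv.swap 0 k i)) c hs hloc ht ?_ ?_
  · rw [Finset.sum_image hinj] at key
    refine le_of_eq_of_le (Finset.sum_congr rfl fun p hp => ?_) key
    rw [Finset.sum_image hinj]
    refine Finset.sum_congr rfl fun p' hp' => ?_
    have ep : p = (q, p.2) := Prod.ext (hq₀ p hp) rfl
    have ep' : p' = (q, p'.2) := Prod.ext (hq₀ p' hp') rfl
    rw [ep, ep']
    dsimp only [hat]
    rw [atomWt_perm hperm _ (Equiv.symm_swap 0 k) hq s y _ hyh p.2,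
      atomWt_perm hperm _ (Equiv.symm_swap 0 k) hq s y _ hyh p'.2, ← sitePermZd_swap_reflSite k hk c q p.2,
      ← M2_swap r hμ k q q (reflSite k c (q, p.2)) p'.2]
  · -- carrier of the transposed atom
    intro ph hph
    have h1 : ph.1 = permPlane (Equiv.swap 0 k) q :=
      Finset.mem_singleton.1 ((atomWt_ne_zero_iff_flat b _ s _ ph).1 hph).1
    have eph : ph = hat (q, sitePermZd (Equiv.swap 0 k) ph.2) :=
      Prod.ext h1 (sitePermZd_swap_swap k ph.2).symm
    rw [eph]
    rw [eph] at hph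
    dsimp only [hat] at hph
    rw [atomWt_perm hperm _ (Equiv.symm_swap 0 k) hq s y _ hyh] at hph
    exact Finset.mem_image_of_mem hat ((hmem₀ _).2 ⟨hS _ hph, hph⟩)
  · -- the side of the transposed mirror
    have h20 : ∀ p : (Fin 4 × Fin 4) × (Fin 4 → ℤ), (hat p).2 0 = p.2 k := fun p => by
      show sitePermZd (Equiv.swap 0 k) p.2 0 = p.2 k
      rw [sitePermZd_apply, Equiv.symm_swap, Equiv.swap_apply_left]
    refine hside.imp (fun h ph hph => ?_) (fun h ph hph => ?_)
    · rw [Finset.mem_image] at hph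
      obtain ⟨p, hp, rfl⟩ := hph
      rw [h20]
      exact h p ((hmem₀ p).1 hp).1
    · rw [Finset.mem_image] at hph
      obtain ⟨p, hp, rfl⟩ := hph
      rw [h20]
      exact h p ((hmem₀ p).1 hp).1

/-- **Scale-local atom ceilings (E1 at one scale).**  For a profile `b` (time-symmetric about `T`, permutation invariant), a state `μ` that
CONTRACTS (`Contracts r μ b`, supplied by the landed `OnsetContraction` for odd-torus limit states) and ONE scale `s`: if every sub-cell-offset
`b`-atom of scale `s` has RP square `≤ η`, then every single-orientation `b`-atom of scale `s` lying on one side of a lattice hyperplane `x_k = c` at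
lattice distance `≥ t/s + 2` from its carrier has reflected two-body double sum `≤ η` (all axes, all planes, both sides). -/
theorem atomCeiling_local [T2Space G] [SecondCountableTopology G] (r : LatticeRep G) {β : ℝ} {μ : Measure (LGConfig 4 G)}
    (hμ : μ ∈ oddTorusLimitPoints r β) (b : SchwartzMap (EuclideanSpace ℝ (Fin 4)) ℝ) (hcon : Contracts r μ b)
    {T : ℝ} (hT : ∀ u : EuclideanSpace ℝ (Fin 4), b (WithLp.toLp 2 fun i => if i = 0 then T - u i else u i) = b u)
    (hperm : ∀ (π : Equiv.Perm (Fin 4)) (u : EuclideanSpace ℝ (Fin 4)), b (WithLp.toLp 2 fun i => u (π i)) = b u)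
    (η : ℝ) (hη : 0 ≤ η) (S : Finset ((Fin 4 × Fin 4) × (Fin 4 → ℤ))) (q : Fin 4 × Fin 4) (s t : ℝ)
    (y : EuclideanSpace ℝ (Fin 4)) (k : Fin 4) (c : ℤ) (hq : q.1 < q.2) (hs : 0 < s)
    (hloc : ∀ (q₁ : Fin 4 × Fin 4) (y₁ : EuclideanSpace ℝ (Fin 4)), (∀ i, 0 ≤ y₁ i ∧ y₁ i ≤ s) → rpSquare r μ b {q₁} s y₁ ≤ η)
    (ht : ∀ u, b u ≠ 0 → ‖u‖ ≤ t) (hS : ∀ p, atomWt b {q} s y p ≠ 0 → p ∈ S)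
    (hside : (∀ p ∈ S, ((p.2 k : ℤ) : ℝ) + t / s + 2 ≤ (c : ℝ)) ∨ (∀ p ∈ S, (c : ℝ) + t / s + 2 ≤ ((p.2 k : ℤ) : ℝ))) :
    ∑ p ∈ S, ∑ p' ∈ S, atomWt b {q} s y p * atomWt b {q} s y p' *
        stateMomentStr G r μ 2 ![p.1, p'.1] ![reflSite k c p, p'.2] ≤ η := by
  by_cases hk : k = 0
  · subst hk
    exact core_zero_local r hμ b hcon hT η hη S q s t y c hs hloc ht hS hside
  · exact core_axis_local r hμ b hcon hT hperm η hη S q s t y k c hk hq hs hloc ht hS hside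

end Summit.QuantumFields.YangMills.Cruxes.HypercubicOSDataFromInfiniteVolume.TemperedCalibration

end
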